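import Summits.Ventures.WeilGRH.DualTrigKernelLatticeDefs
import HarnessLib

/-!
# Format D-K v3 (multi-lattice): soundness of the cells — the phase source `phase3`, the moments, the two
cell bounds

Cell `rh-explicit`, WEIL TRACK — GRH ARM, route B (weil-grh-3).  The cell machinery of a v3 certificate
(`DKCert3.phase3`, `moments3`, `cellLo3`, `cellLoT3`, `DualTrigKernelLatticeDefs.lean`) is the generic one of
`DualTrigKernelDefs/Check.lean` with ONE change: non-integer-frequency terms get their centre phase from
`MC.expI` with the short series `K2`/`k2`.  Since `MC.mem_expI` holds for every series length, the proofs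
are those of `DualTrigKernelSoundA/C.lean` verbatim: `mem_phase3`, `moments3_mem`, `cellLo3_sound` (full
inequality and base periodic part on a cell), and `cellLoT3_sound` (the trigonometric lower bound of a
whole term list, for the lattice duties).  Everything here is PROVED; no named facts, no `sorry`, no kernel
evaluation.
-/

noncomputable section

open Finset Real Complex

namespace Summit.Ventures.WeilGRH

open Literature.Analysis.ValidatedNumerics.NumericsMP
open Literature.NumberTheory.LFunctions
open DualTrigTaylor DigammaVertical

namespace DKCert3

variable {c : DKCert3}

/-! ### The phase source and the moments -/

/-- The centre phase `phase3` encloses `cos κθ_c`, `sin κθ_c`, `θ_c = (2j+1)π/Mc` (table path as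
`DKCert.mem_phase`, `expI` path by `MC.mem_expI` for the short series). [folklore] -/
theorem mem_phase3 (hS : 0 < c.base.S) (hpi : MI.mem c.base.S Real.pi c.base.piI) {b : DKBlock}
    (htab : c.base.tabOK b = true) (hMc : 1 ≤ b.Mc) {t : DKCert.GTerm} {rt : RTerm}
    (h : DKCert.GRepr c.base.S c.base.R t rt) (j : ℤ) {Z : MC} (hZ : c.phase3 b j t = some Z) :
    MI.mem c.base.S (Real.cos (rt.κ * ((2 * j + 1) * π / b.Mc))) Z.re ∧
      MI.mem c.base.S (Real.sin (rt.κ * ((2 * j + 1) * π / b.Mc))) Z.im := by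
  unfold phase3 at hZ
  by_cases hi : t.isInt = true
  · rw [if_pos hi] at hZ
    exact DKCert.mem_phase hS hpi htab hMc h j hZ
  · rw [if_neg hi] at hZ
    have hθc : MI.mem c.base.S ((2 * j + 1) * π / b.Mc) ((c.base.piI.mulInt (2 * j + 1)).divNat b.Mc) := by
      have := MI.mem_divNat (MI.mem_mulInt hpi (2 * j + 1)) (n := b.Mc) (by omega)
      convert this using 1; push_cast; ring
    have harg := MI.mem_mul hS h.memK hθc
    have hE := MC.mem_expI hS hpi hZ harg
    have h1 := hE.1
    have h2 := hE.2
    rw [Complex.exp_ofReal_mul_I_re] at h1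
    rw [Complex.exp_ofReal_mul_I_im] at h2
    exact ⟨h1, h2⟩

/-- **The moment accumulators of `moments3` enclose the real moments** (all terms, and the non-periodic
ones), at the centre `θc = (2j+1)π/Mc`. [folklore] -/
theorem moments3_mem (hS : 0 < c.base.S) (hpi : MI.mem c.base.S Real.pi c.base.piI) {b : DKBlock}
    (htab : c.base.tabOK b = true) (hMc : 1 ≤ b.Mc) (j : ℤ) :
    ∀ {ts : List DKCert.GTerm} {rts : List RTerm}, List.Forall₂ (DKCert.GRepr c.base.S c.base.R) ts rts →
      ∀ {acc : List MI × List MI}, c.moments3 b j ts = some acc →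
        DKCert.MomMem c.base rts ((2 * j + 1) * π / b.Mc) acc.1 ∧
          DKCert.MomMem c.base (DKCert.ncList ts rts) ((2 * j + 1) * π / b.Mc) acc.2 := by
  intro ts rts hF
  induction hF with
  | nil =>
      intro acc hacc
      simp only [moments3, Option.some.injEq] at hacc
      subst hacc
      exact ⟨DKCert.momMem_zero _, by simpa [DKCert.ncList] using DKCert.momMem_zero (c := c.base) _⟩
  | @cons t rt ts rts hh hF ih =>
      intro acc hacc
      cases hrec : c.moments3 b j ts with
      | none => simp [moments3, hrec] at hacc
      | some acc' =>
        obtain ⟨accA, accN⟩ := acc'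
        obtain ⟨ihA, ihN⟩ := ih hrec
        cases hZ : c.phase3 b j t with
        | none => simp [moments3, hrec, hZ] at hacc
        | some Z =>
          simp only [moments3, hrec, hZ, Option.some.injEq] at hacc
          subst hacc
          obtain ⟨hc, hs⟩ := mem_phase3 hS hpi htab hMc hh j hZ
          obtain ⟨hU, hV⟩ := DKCert.mem_rotUV hS hh hc hs
          refine ⟨DKCert.momMem_addTerm hS hh hU hV ihA, ?_⟩
          by_cases hcomm : t.comm = true
          · simpa [DKCert.ncList, hcomm] using ihN
          · simpa [DKCert.ncList, hcomm] using DKCert.momMem_addTerm hS hh hU hV ihN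

/-! ### The two cell bounds -/

/-- **The cell theorem (v3 phase source).**  If `cellLo3 b ts E j = some (lo, loT)` (with `E` the block
remainder), then on the cell `θ ∈ [2πj/Mc, 2π(j+1)/Mc]` the full function is `≥ lo/S` and the base periodic
part `≥ loT/S`.  The proof is `DKCert.cellLo_sound` with `moments3_mem`. [folklore] -/
theorem cellLo3_sound (hS : 0 < c.base.S) (hpi : MI.mem c.base.S Real.pi c.base.piI) {ρ : ℝ} (hρ : 0 < ρ)
    (hrho : MI.mem c.base.S ρ c.base.rhoI) {Cr : ℝ} (hC : MI.mem c.base.S Cr c.base.constI) (hR : 1 ≤ c.base.R)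
    {b : DKBlock} (hMc : 1 ≤ b.Mc) (hden : 1 ≤ b.etaDen) (hnin : 1 ≤ b.nin) (hnum : 1 ≤ b.etaNum)
    (heta : Real.pi / b.Mc ≤ (b.etaNum : ℝ) / b.etaDen) (htab : c.base.tabOK b = true)
    {ts : List DKCert.GTerm} {rts : List RTerm} (hF : List.Forall₂ (DKCert.GRepr c.base.S c.base.R) ts rts) (j : ℤ)
    {lo loT : ℤ} (h : c.cellLo3 b ts (c.base.remBlock (c.base.etaPow b) ts) j = some (lo, loT))
    {θ : ℝ} (hθ1 : 2 * π * j / b.Mc ≤ θ) (hθ2 : θ ≤ 2 * π * (j + 1) / b.Mc) :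
    ((lo : ℝ) / c.base.S ≤ (Complex.digamma ((c.base.sigR : ℂ) + (ρ * θ : ℝ) * I)).re + Cr + sumVal rts θ) ∧
      ((loT : ℝ) / c.base.S ≤ sumVal (DKCert.cList ts rts) θ) := by
  have hSr : (0 : ℝ) < c.base.S := by exact_mod_cast hS
  have hMcr : (0 : ℝ) < b.Mc := by exact_mod_cast hMc
  set θc : ℝ := (2 * j + 1) * π / b.Mc with hθc
  set ηr : ℝ := (b.etaNum : ℝ) / b.etaDen with hηr
  have hη0 : 0 ≤ ηr := by rw [hηr]; positivity
  set φ : ℝ := θ - θc with hφ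
  have hθφ : θ = θc + φ := by rw [hφ]; ring
  have hφabs : |φ| ≤ ηr := by
    refine le_trans ?_ heta
    rw [abs_le]; constructor
    · rw [hφ, hθc]; have : 2 * π * j / b.Mc = (2 * j + 1) * π / b.Mc - π / b.Mc := by field_simp; ring
      linarith
    · rw [hφ, hθc]; have : 2 * π * (j + 1) / b.Mc = (2 * j + 1) * π / b.Mc + π / b.Mc := by
        field_simp; ring
      linarith
  -- unpack cellLo
  unfold cellLo3 at h
  cases hmom : c.moments3 b j ts with
  | none => simp [hmom] at h
  | some acc =>
  cases hdig : c.base.digammaData b j with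
  | none => simp [hmom, hdig] at h
  | some dd =>
  obtain ⟨BR, F0, F1, EF⟩ := dd
  simp only [hmom, hdig, Option.some.injEq, Prod.mk.injEq] at h
  obtain ⟨hlo, hloT⟩ := h
  -- the trig data
  obtain ⟨hmA, hmN⟩ := moments3_mem hS hpi htab hMc j hF hmom
  have hmT := DKCert.periodicMom_mem hF hmA hmN
  have hep := DKCert.etaPow_mem hS hden (b := b)
  have hrem := DKCert.remSum_le_remBlock_hi hS hη0 hep hF
  have htrig := sum_sub_remSum_le_sumVal θc hφabs c.base.R rts
  have htrigT := sum_sub_remSum_le_sumVal θc hφabs c.base.R (DKCert.cList ts rts)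
  have hremT := DKCert.remSum_cList_le hη0 c.base.R ts rts
  rw [← hθφ] at htrig htrigT
  -- the digamma data
  obtain ⟨F0r, F1r, hF0m, hF1m, hBRth, hD⟩ := DKCert.digammaData_sound hS hpi hρ hrho hMc hden j hdig
  have hBRm : MI.mem c.base.S ((BR.lo : ℝ) / c.base.S) BR := by
    have := DKCert.mem_thin hS BR.lo
    have e : (⟨BR.lo, BR.lo⟩ : MI) = BR := by
      cases BR with | mk lo hi => simp only at hBRth; simp [hBRth]
    rw [e] at this; exact this
  have hDθ := hD θ hθ1 hθ2 hφabs
  -- coefficient lists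
  set cs := c.base.coeffs acc.1 with hcs
  have hlen : cs.length = 2 * c.base.R := DKCert.coeffs_length _
  obtain ⟨c0, c1, rest, hsplit⟩ : ∃ c0 c1 rest, cs = c0 :: c1 :: rest := by
    match hh : cs, hlen with
    | [], hl => simp at hl; omega
    | [_], hl => simp at hl; omega
    | c0 :: c1 :: rest, _ => exact ⟨c0, c1, rest, rfl⟩
  have hcm : DKCert.CoefMem c.base (fun m ↦ coefSum rts θc m) cs := by
    intro m hm; rw [hlen] at hm; exact DKCert.coeffs_mem hmA m hm
  set cr' : ℕ → ℝ := fun m ↦ coefSum rts θc m +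
    (if m = 0 then (BR.lo : ℝ) / c.base.S + F0r + Cr else 0) + (if m = 1 then F1r else 0) with hcr'
  set cs' := (((c0.add BR).add F0).add c.base.constI) :: (c1.add F1) :: rest with hcs'
  have hcm' : DKCert.CoefMem c.base cr' cs' := by
    intro m hm
    have hm2 : m < cs.length := by rw [hsplit]; rw [hcs'] at hm; simpa using hm
    have hbase := hcm m hm2
    rw [hsplit] at hbase
    rcases m with _ | _ | m
    · have e : cr' 0 = coefSum rts θc 0 + ((BR.lo : ℝ) / c.base.S + F0r + Cr) := by simp [hcr']
      rw [e, hcs']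
      simp only [List.getD_cons_zero] at hbase ⊢
      have := MI.mem_add (MI.mem_add (MI.mem_add hbase hBRm) hF0m) hC
      have e2 : coefSum rts θc 0 + ((BR.lo : ℝ) / c.base.S + F0r + Cr) =
          coefSum rts θc 0 + (BR.lo : ℝ) / c.base.S + F0r + Cr := by ring
      rw [e2]; exact this
    · have e : cr' 1 = coefSum rts θc 1 + F1r := by simp [hcr']
      rw [e, hcs']
      simp only [List.getD_cons_succ, List.getD_cons_zero] at hbase ⊢
      exact MI.mem_add hbase hF1m
    · have e : cr' (m + 2) = coefSum rts θc (m + 2) := by simp [hcr']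
      rw [e, hcs']
      simp only [List.getD_cons_succ] at hbase ⊢
      exact hbase
  have hlen' : cs'.length = 2 * c.base.R := by
    rw [hcs']; rw [hsplit] at hlen; simpa using hlen
  have hpoly := DKCert.poly_ge_innerLo hS hden hnin hnum hcm' hφabs
  rw [hlen'] at hpoly
  -- the polynomial splits
  have hsplitpoly : DKCert.polyR cr' (2 * c.base.R) φ =
      (∑ m ∈ range (2 * c.base.R), coefSum rts θc m * φ ^ m) + ((BR.lo : ℝ) / c.base.S + F0r + Cr) + F1r * φ := by
    simp only [DKCert.polyR, hcr', add_mul, Finset.sum_add_distrib, ite_mul, zero_mul]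
    rw [Finset.sum_ite_eq' (range (2 * c.base.R)) 0, Finset.sum_ite_eq' (range (2 * c.base.R)) 1]
    simp only [Finset.mem_range, show 0 < 2 * c.base.R by omega, show 1 < 2 * c.base.R by omega, if_true,
      pow_zero, mul_one, pow_one]
  -- first conclusion
  have hE : remSum rts ηr c.base.R ≤ (((c.base.remBlock (c.base.etaPow b) ts).hi : ℤ) : ℝ) / c.base.S := hrem
  refine ⟨?_, ?_⟩
  · rw [hsplit] at hlo
    dsimp only at hlo
    have : ((lo : ℤ) : ℝ) / c.base.S = ((c.base.innerLo b cs' : ℤ) : ℝ) / c.base.S -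
        (((c.base.remBlock (c.base.etaPow b) ts).hi : ℤ) : ℝ) / c.base.S - ((EF.hi : ℤ) : ℝ) / c.base.S := by
      rw [← hlo, hcs']; push_cast; ring
    rw [this]
    linarith [hpoly, hsplitpoly, htrig, hDθ]
  · -- periodic part
    set csT := c.base.coeffs (c.base.periodicMom acc) with hcsT
    have hlenT : csT.length = 2 * c.base.R := DKCert.coeffs_length _
    have hcmT : DKCert.CoefMem c.base (fun m ↦ coefSum (DKCert.cList ts rts) θc m) csT := by
      intro m hm; rw [hlenT] at hm; exact DKCert.coeffs_mem hmT m hm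
    have hpolyT := DKCert.poly_ge_innerLo hS hden hnin hnum hcmT hφabs
    rw [hlenT] at hpolyT
    have : ((loT : ℤ) : ℝ) / c.base.S = ((c.base.innerLo b csT : ℤ) : ℝ) / c.base.S -
        (((c.base.remBlock (c.base.etaPow b) ts).hi : ℤ) : ℝ) / c.base.S := by
      rw [← hloT, hcsT]; push_cast; ring
    rw [this]
    have hpr : DKCert.polyR (fun m ↦ coefSum (DKCert.cList ts rts) θc m) (2 * c.base.R) φ =
        ∑ m ∈ range (2 * c.base.R), coefSum (DKCert.cList ts rts) θc m * φ ^ m := rfl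
    linarith [hpolyT, htrigT, hremT]


/-- **The cell bound without digamma (v3 phase source).**  If `cellLoT3 b ts E j = some lo` (with `E` the
block remainder of `ts`), then on the cell the sum of the real terms is `≥ lo/S`. [folklore] -/
theorem cellLoT3_sound (hS : 0 < c.base.S) (hpi : MI.mem c.base.S Real.pi c.base.piI)
    {b : DKBlock} (hMc : 1 ≤ b.Mc) (hden : 1 ≤ b.etaDen) (hnin : 1 ≤ b.nin) (hnum : 1 ≤ b.etaNum)
    (heta : Real.pi / b.Mc ≤ (b.etaNum : ℝ) / b.etaDen) (htab : c.base.tabOK b = true)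
    {ts : List DKCert.GTerm} {rts : List RTerm} (hF : List.Forall₂ (DKCert.GRepr c.base.S c.base.R) ts rts) (j : ℤ)
    {lo : ℤ} (h : c.cellLoT3 b ts (c.base.remBlock (c.base.etaPow b) ts) j = some lo)
    {θ : ℝ} (hθ1 : 2 * π * j / b.Mc ≤ θ) (hθ2 : θ ≤ 2 * π * (j + 1) / b.Mc) :
    (lo : ℝ) / c.base.S ≤ sumVal rts θ := by
  have hMcr : (0 : ℝ) < b.Mc := by exact_mod_cast hMc
  set θc : ℝ := (2 * j + 1) * π / b.Mc with hθc
  set ηr : ℝ := (b.etaNum : ℝ) / b.etaDen with hηr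
  have hη0 : 0 ≤ ηr := by rw [hηr]; positivity
  set φ : ℝ := θ - θc with hφ
  have hθφ : θ = θc + φ := by rw [hφ]; ring
  have hφabs : |φ| ≤ ηr := by
    refine le_trans ?_ heta
    rw [abs_le]; constructor
    · rw [hφ, hθc]; have : 2 * π * j / b.Mc = (2 * j + 1) * π / b.Mc - π / b.Mc := by field_simp; ring
      linarith
    · rw [hφ, hθc]; have : 2 * π * (j + 1) / b.Mc = (2 * j + 1) * π / b.Mc + π / b.Mc := by
        field_simp; ring
      linarith
  unfold cellLoT3 at h
  cases hmom : c.moments3 b j ts with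
  | none => simp [hmom] at h
  | some acc =>
  simp only [hmom, Option.some.injEq] at h
  obtain ⟨hmA, _⟩ := moments3_mem hS hpi htab hMc j hF hmom
  have hep := DKCert.etaPow_mem hS hden (b := b)
  have hrem := DKCert.remSum_le_remBlock_hi hS hη0 hep hF
  have htrig := sum_sub_remSum_le_sumVal θc hφabs c.base.R rts
  rw [← hθφ] at htrig
  set cs := c.base.coeffs acc.1 with hcs
  have hlen : cs.length = 2 * c.base.R := DKCert.coeffs_length _
  have hcm : DKCert.CoefMem c.base (fun m ↦ coefSum rts θc m) cs := by
    intro m hm; rw [hlen] at hm; exact DKCert.coeffs_mem hmA m hm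
  have hpoly := DKCert.poly_ge_innerLo hS hden hnin hnum hcm hφabs
  rw [hlen] at hpoly
  have : ((lo : ℤ) : ℝ) / c.base.S = ((c.base.innerLo b cs : ℤ) : ℝ) / c.base.S -
      (((c.base.remBlock (c.base.etaPow b) ts).hi : ℤ) : ℝ) / c.base.S := by
    rw [← h, hcs]; push_cast; ring
  rw [this]
  have hpr : DKCert.polyR (fun m ↦ coefSum rts θc m) (2 * c.base.R) φ =
      ∑ m ∈ range (2 * c.base.R), coefSum rts θc m * φ ^ m := rfl
  linarith [hpoly, htrig, hrem]

end DKCert3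

end Summit.Ventures.WeilGRH

end
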